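import Literature.NumberTheory.LFunctions.GaussianHeckeThetaFE
import HarnessLib

/-!
# Coset theta series of `ℤ[i]` with harmonic weights `z^k` and their transformation formula

Topic `Literature/NumberTheory/LFunctions`, next to `GaussianHeckeThetaFE.lean` (the case `M = 1`:
`θ_k(1/t) = i^k t^{k+1} θ_k(t)` for `θ_k(t) = ∑_{z ∈ ℤ[i]} z^k e^{-πtN(z)}`) and
`GaussianThetaSeries.lean` (weight `k = 1`, classes modulo `M`, via Mathlib's Hurwitz kernels).
This file treats ALL weights `k ≥ 0` AND all cosets `c + Mℤ[i]` at once — the analytic input for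
the continuation and functional equation of the Hecke `L`-functions
`L(s, ψ) = ∑_{z primary} χ(z) (z/|z|)^k N(z)^{-s}` of `ℚ(i)` with a character `χ` of
`(ℤ[i]/Mℤ[i])ˣ` and a Grössencharakter `(z/|z|)^k` (Hecke 1920 §9), as used in §16 of
J. Friedlander, H. Iwaniec, *The polynomial `X² + Y⁴` captures its primes*, Ann. of Math. 148
(1998) ("To the character (16.16) we attach the `L`-function (16.17) … This has a meromorphic
continuation to `ℂ` … There is also a functional equation for `χ` primitive proved by Hecke").
Everything here is PROVED; no named facts.

For `M ≥ 1`, `c ∈ ℤ[i]`, `k : ℕ` and `t, u > 0` put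

  `Θ_k(t; c, M) = ∑_{z ≡ c (mod M)} z^k e^{-π t N(z)/M}`           (`theta M c k t`),
  `Θ̂_k(u; c, M) = ∑_{y ∈ ℤ[i]} e(Re(y c̄)/M) y^k e^{-π u N(y)/M}`   (`dualTheta M c k u`).

**Main results.**

* `theta_eq_dualTheta` — `Θ_k(t; c, M) = (Mt)⁻¹ (-i/t)^k Θ̂_k(1/t; c, M)`;
* `theta_one_div` — `Θ_k(1/x; c, M) = (-i)^k M⁻¹ x^{k+1} Θ̂_k(x; c, M)` (the shape
  `f(1/x) = ε x^{k+1} g(x)` of Mathlib's `WeakFEPair`, `ε = (-i)^k/M`; for `M = 1`, `c = 0` this is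
  `GaussianHecke.theta_one_div`).

Since `e(Re(y c̄)/M)` is `M`-periodic in `y`, `Θ̂_k(·; c, M)` is the finite Fourier combination
`∑_{b mod M} e(Re(b c̄)/M) Θ_k(·; b, M)` of coset theta series (the regrouping is carried out in the
sequel, with the Mellin transforms); so the family `{Θ_k(·; c, M)}_c` is closed under `t ↦ 1/t`.

## The proof (generating functions, after `GaussianHeckeThetaFE`)

Two-dimensional Poisson summation with harmonic polynomial weights is avoided: for `t > 0` the
coset generating function

  `G_c(t; w) = ∑_{z ≡ c (M)} e^{-π t N(z)/M} e^{2πi w z}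
            = e^{-πtN(c)/M + 2πiwc} · ϑ(Mw + ic₁t, iMt) · ϑ(iMw + ic₂t, iMt)`       (`hasSum_genFun`)

is a product of two SHIFTED Jacobi theta functions (Mathlib's `jacobiTheta₂`), and the dual family

  `Ĝ_c(u; w) = ∑_y e(Re(y c̄)/M) e^{-π u N(y)/M} e^{2πi w y} = ϑ(w + c₁/M, iu/M) · ϑ(iw + c₂/M, iu/M)`
                                                                              (`hasSum_dualGenFun`)

a product of two TWISTED ones. Jacobi's `ϑ(z, τ) = (-iτ)^{-1/2} e^{-πiz²/τ} ϑ(z/τ, -1/τ)`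
(`jacobiTheta₂_functional_equation`) applied to both factors of `G_c` gives EXACTLY

  `G_c(t; w) = (Mt)⁻¹ Ĝ_c(1/t; -iw/t)`                               (`genFun_functional_equation`):

the two Gaussian prefactors multiply to `e^{-2πiwc + πtN(c)/M}` (harmonicity), cancelling the
prefactor of `G_c`. Both sides are entire power series in `w` (a general lemma for Gaussian
families `ρ(y) e^{-πsN(Py)} e^{2πiwaPy}`, `hasFPowerSeriesOnBall_of_hasSum`, majorised through
`GaussianHecke.summable_majorant`); the coefficient of `w^k` is `(2πi)^k/k! · Θ_k(t; c, M)` on the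
left and `(Mt)⁻¹ (-i/t)^k (2πi)^k/k! · Θ̂_k(1/t; c, M)` on the right, and power-series coefficients
are unique (`HasFPowerSeriesAt.eq_formalMultilinearSeries_of_eventually`).

## Contents

`pt M c y = c + M y`, `addChar M c y = e(Re(y c̄)/M)` (`norm_addChar`); `genTerm`/`genFun`,
`dualGenTerm`/`dualGenFun`, `genTerm_eq`, `dualGenTerm_eq`, `hasSum_genFun`, `hasSum_dualGenFun`,
`genFun_functional_equation`; the general family `famTerm`/`famCoeff`/`famDbl` with
`summable_famDbl`, `hasSum_famCoeff_mul_pow`, `radius_ofScalars_famCoeff`,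
`hasFPowerSeriesOnBall_of_hasSum`; `thetaTerm`/`theta`, `dualThetaTerm`/`dualTheta`,
`summable_norm_thetaTerm`, `hasSum_theta`, `summable_norm_dualThetaTerm`, `hasSum_dualTheta`,
`famCoeff_gen_eq`, `famCoeff_transformed_eq`, `famCoeff_gen_eq_transformed`,
**`theta_eq_dualTheta`**, **`theta_one_div`**.

## References

* E. Hecke, *Eine neue Art von Zetafunktionen und ihre Beziehungen zur Verteilung der
  Primzahlen. II*, Math. Z. 6 (1920), 11–51, §9 (theta series of an imaginary quadratic field
  with Grössencharakteren and congruence conditions). [HeckeMathZ1920]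
* J. Friedlander, H. Iwaniec, Ann. of Math. (2) 148 (1998), 945–1040, §16, (16.16)–(16.17) and
  the functional equation quoted after (16.17) (the consumer). [FriedlanderIwaniecAnnals1998]

## Mathlib / tree

Mathlib: `jacobiTheta₂`, `jacobiTheta₂_term`, `hasSum_jacobiTheta₂_term`,
`jacobiTheta₂_functional_equation`, `NormedSpace.expSeries_div_hasSum_exp`,
`FormalMultilinearSeries.radius_eq_top_of_summable_norm`,
`HasFPowerSeriesAt.eq_formalMultilinearSeries_of_eventually`, `Summable.comp_injective`.
Tree: `GaussianHecke.pairEquiv`, `norm_cast_real`, `norm_ofReal_exp`, `summable_exp_mul_exp`,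
`summable_majorant`, and the model `GaussianHecke.theta_one_div` (`GaussianHeckeThetaFE`).
-/

noncomputable section

open Complex Real Filter Topology
open scoped Nat

namespace Literature.NumberTheory.LFunctions

namespace GaussianCosetTheta

local notation "ℤ[i]" => GaussianInt

open GaussianHecke (pairEquiv norm_cast_real norm_ofReal_exp)

variable (M : ℕ) (c : ℤ[i])

/-! ### The coset `c + M ℤ[i]` -/

/-- The point `c + M y` of the coset `c + M ℤ[i]`. [folklore] -/
def pt (y : ℤ[i]) : ℤ[i] := c + M * y

/-- Real part of `c + M y`. [folklore] -/
@[simp] theorem pt_re (y : ℤ[i]) : (pt M c y).re = c.re + M * y.re := by simp [pt]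

/-- Imaginary part of `c + M y`. [folklore] -/
@[simp] theorem pt_im (y : ℤ[i]) : (pt M c y).im = c.im + M * y.im := by simp [pt]

/-- `y ↦ c + M y` is injective for `M ≠ 0`. [folklore] -/
theorem pt_injective [NeZero M] : Function.Injective (pt M c) := by
  intro y y' h
  have hM : (M : ℤ) ≠ 0 := by exact_mod_cast NeZero.ne M
  have h1 := congrArg Zsqrtd.re h
  have h2 := congrArg Zsqrtd.im h
  simp only [pt_re, pt_im, add_right_inj] at h1 h2
  exact Zsqrtd.ext (mul_left_cancel₀ hM h1) (mul_left_cancel₀ hM h2)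

/-- `c + M y` as a complex number. [folklore] -/
theorem toComplex_pt (y : ℤ[i]) :
    ((pt M c y : ℤ[i]) : ℂ) = ((c.re : ℂ) + M * y.re) + ((c.im : ℂ) + M * y.im) * I := by
  apply Complex.ext <;> simp [pt]

/-- `N(c + M y)` in `ℝ`. [folklore] -/
theorem norm_pt (y : ℤ[i]) :
    (((pt M c y).norm : ℤ) : ℝ) = ((c.re : ℝ) + M * y.re) ^ 2 + ((c.im : ℝ) + M * y.im) ^ 2 := by
  rw [norm_cast_real, pt_re, pt_im]
  push_cast
  ring

/-- The additive character `y ↦ e(Re(y c̄)/M) = e^{2πi (y₁ c₁ + y₂ c₂)/M}` pairing the coset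
label `c` with `y ∈ ℤ[i]`. [folklore] -/
def addChar (y : ℤ[i]) : ℂ := cexp (2 * π * I * (((y * star c).re : ℤ) : ℂ) / M)

/-- `Re(y c̄) = y₁ c₁ + y₂ c₂`. [folklore] -/
theorem re_mul_star (y : ℤ[i]) : (y * star c).re = y.re * c.re + y.im * c.im := by
  simp

/-- `|e(Re(y c̄)/M)| = 1`. [folklore] -/
theorem norm_addChar (y : ℤ[i]) : ‖addChar M c y‖ = 1 := by
  rw [addChar, Complex.norm_exp]
  have : (2 * π * I * (((y * star c).re : ℤ) : ℂ) / M).re = 0 := by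
    simp [mul_re, mul_im, div_re]
  rw [this, Real.exp_zero]


/-! ### The generating functions -/

/-- The summand `e^{-π t N(z)/M} e^{2πi w z}` of the coset generating function, `z = c + M y`.
[folklore] -/
def genTerm (t : ℝ) (w : ℂ) (y : ℤ[i]) : ℂ :=
  ((rexp (-π * t * ((pt M c y).norm : ℝ) / M) : ℝ) : ℂ) * cexp (2 * π * I * w * ((pt M c y : ℤ[i]) : ℂ))

/-- The coset generating function `G_c(t; w) = ∑_{z ≡ c (M)} e^{-π t N(z)/M} e^{2πi w z}`, DEFINED
in closed form: `e^{-π t N(c)/M + 2πi w c} · ϑ(M w + i c₁ t, i M t) · ϑ(i M w + i c₂ t, i M t)`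
(`hasSum_genFun`). [folklore] -/
def genFun (t : ℝ) (w : ℂ) : ℂ :=
  cexp ((((-π * t * (c.norm : ℝ) / M) : ℝ) : ℂ) + 2 * π * I * w * (c : ℂ)) *
    (jacobiTheta₂ (M * w + (c.re : ℂ) * (I * t)) (I * ((M : ℂ) * t)) *
      jacobiTheta₂ (M * (I * w) + (c.im : ℂ) * (I * t)) (I * ((M : ℂ) * t)))

/-- The summand `e(Re(y c̄)/M) e^{-π u N(y)/M} e^{2πi w y}` of the dual generating function.
[folklore] -/
def dualGenTerm (u : ℝ) (w : ℂ) (y : ℤ[i]) : ℂ :=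
  addChar M c y * (((rexp (-π * u * (y.norm : ℝ) / M) : ℝ) : ℂ) * cexp (2 * π * I * w * (y : ℂ)))

/-- The dual generating function `Ĝ_c(u; w) = ∑_{y ∈ ℤ[i]} e(Re(y c̄)/M) e^{-π u N(y)/M} e^{2πi w y}`,
DEFINED as `ϑ(w + c₁/M, i u/M) · ϑ(i w + c₂/M, i u/M)` (`hasSum_dualGenFun`). [folklore] -/
def dualGenFun (u : ℝ) (w : ℂ) : ℂ :=
  jacobiTheta₂ (w + (c.re : ℂ) / M) (I * u / M) * jacobiTheta₂ (I * w + (c.im : ℂ) / M) (I * u / M)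

variable [NeZero M]

/-- `M > 0` in `ℝ`. [folklore] -/
theorem M_pos : (0 : ℝ) < M := by exact_mod_cast Nat.pos_of_ne_zero (NeZero.ne M)

/-- Product of the two one-dimensional summands of `G_c`: for `y = a + b i`,
`e^{-πtN(c)/M + 2πiwc} · ϑ-term_a(Mw + ic₁t, iMt) · ϑ-term_b(iMw + ic₂t, iMt) = e^{-πtN(z)/M} e^{2πiwz}`,
`z = c + M y`. [folklore] -/
theorem genTerm_eq (t : ℝ) (w : ℂ) (a b : ℤ) :
    cexp ((((-π * t * (c.norm : ℝ) / M) : ℝ) : ℂ) + 2 * π * I * w * (c : ℂ)) *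
      (jacobiTheta₂_term a (M * w + (c.re : ℂ) * (I * t)) (I * ((M : ℂ) * t)) *
        jacobiTheta₂_term b (M * (I * w) + (c.im : ℂ) * (I * t)) (I * ((M : ℂ) * t))) =
      genTerm M c t w ⟨a, b⟩ := by
  rw [genTerm, jacobiTheta₂_term, jacobiTheta₂_term, ← Complex.exp_add, ← Complex.exp_add,
    Complex.ofReal_exp, ← Complex.exp_add]
  congr 1
  have hn : (((pt M c ⟨a, b⟩).norm : ℤ) : ℂ) = ((c.re : ℂ) + M * a) ^ 2 + ((c.im : ℂ) + M * b) ^ 2 := by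
    rw [Zsqrtd.norm_def, pt_re, pt_im]; push_cast; ring
  have hc : ((c.norm : ℤ) : ℂ) = (c.re : ℂ) ^ 2 + (c.im : ℂ) ^ 2 := by
    rw [Zsqrtd.norm_def]; push_cast; ring
  have hp : ((pt M c ⟨a, b⟩ : ℤ[i]) : ℂ) = ((c.re : ℂ) + M * a) + ((c.im : ℂ) + M * b) * I := by
    rw [toComplex_pt]
  have hM : (M : ℂ) ≠ 0 := by exact_mod_cast NeZero.ne M
  rw [hp, GaussianInt.toComplex_def c]
  push_cast
  rw [hn, hc]
  have key : (((c.re : ℂ) + M * a) ^ 2 + ((c.im : ℂ) + M * b) ^ 2) / (M : ℂ) =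
      ((c.re : ℂ) ^ 2 + (c.im : ℂ) ^ 2) / M +
        (2 * a * (c.re : ℂ) + M * a ^ 2 + 2 * b * (c.im : ℂ) + M * b ^ 2) := by
    field_simp
    ring
  linear_combination (π * t * (2 * a * (c.re : ℂ) + M * a ^ 2 + 2 * b * (c.im : ℂ) + M * b ^ 2)) * I_sq
    + (π * t) * key


omit [NeZero M] in
/-- Product of the two one-dimensional summands of `Ĝ_c`: for `y = a + b i`,
`ϑ-term_a(w + c₁/M, iu/M) · ϑ-term_b(iw + c₂/M, iu/M) = e(Re(y c̄)/M) e^{-πuN(y)/M} e^{2πiwy}`.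
[folklore] -/
theorem dualGenTerm_eq (u : ℝ) (w : ℂ) (a b : ℤ) :
    jacobiTheta₂_term a (w + (c.re : ℂ) / M) (I * u / M) *
        jacobiTheta₂_term b (I * w + (c.im : ℂ) / M) (I * u / M) =
      dualGenTerm M c u w ⟨a, b⟩ := by
  rw [dualGenTerm, addChar, jacobiTheta₂_term, jacobiTheta₂_term, ← Complex.exp_add,
    Complex.ofReal_exp, ← Complex.exp_add, ← Complex.exp_add]
  congr 1
  have hn : (((⟨a, b⟩ : ℤ[i]).norm : ℤ) : ℂ) = (a : ℂ) ^ 2 + (b : ℂ) ^ 2 := by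
    rw [Zsqrtd.norm_def]; push_cast; ring
  have hr : ((((⟨a, b⟩ : ℤ[i]) * star c).re : ℤ) : ℂ) = a * (c.re : ℂ) + b * (c.im : ℂ) := by
    rw [re_mul_star]; push_cast; ring
  rw [GaussianInt.toComplex_def' a b]
  push_cast
  rw [hn, hr]
  linear_combination (π * u * ((a : ℂ) ^ 2 + (b : ℂ) ^ 2) / M) * I_sq

/-- **`G_c(t; w) = ∑_{z ≡ c (M)} e^{-π t N(z)/M} e^{2πi w z}`** for `t > 0`. [folklore] -/
theorem hasSum_genFun {t : ℝ} (ht : 0 < t) (w : ℂ) : HasSum (genTerm M c t w) (genFun M c t w) := by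
  have hτ : 0 < (I * ((M : ℂ) * t)).im := by
    rw [mul_im, I_re, I_im, zero_mul, one_mul, zero_add, ← ofReal_natCast, ← ofReal_mul, ofReal_re]
    exact mul_pos (M_pos M) ht
  have hA := hasSum_jacobiTheta₂_term ((M : ℂ) * w + (c.re : ℂ) * (I * t)) hτ
  have hB := hasSum_jacobiTheta₂_term ((M : ℂ) * (I * w) + (c.im : ℂ) * (I * t)) hτ
  have h3 := summable_mul_of_summable_norm hA.summable.norm hB.summable.norm
  have hP := (hA.mul hB h3).mul_left
    (cexp ((((-π * t * (c.norm : ℝ) / M) : ℝ) : ℂ) + 2 * π * I * w * (c : ℂ)))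
  have hQ : HasSum (genTerm M c t w ∘ pairEquiv) (genFun M c t w) := by
    refine hP.congr_fun fun p ↦ ?_
    exact (genTerm_eq M c t w p.1 p.2).symm
  exact pairEquiv.hasSum_iff.1 hQ

/-- **`Ĝ_c(u; w) = ∑_{y} e(Re(y c̄)/M) e^{-π u N(y)/M} e^{2πi w y}`** for `u > 0`. [folklore] -/
theorem hasSum_dualGenFun {u : ℝ} (hu : 0 < u) (w : ℂ) :
    HasSum (dualGenTerm M c u w) (dualGenFun M c u w) := by
  have hτ : 0 < (I * (u : ℂ) / M).im := by
    rw [← ofReal_natCast, mul_div_assoc, ← ofReal_div, mul_im, I_re, I_im, zero_mul, one_mul,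
      zero_add, ofReal_re]
    exact div_pos hu (M_pos M)
  have hA := hasSum_jacobiTheta₂_term (w + (c.re : ℂ) / M) hτ
  have hB := hasSum_jacobiTheta₂_term (I * w + (c.im : ℂ) / M) hτ
  have h3 := summable_mul_of_summable_norm hA.summable.norm hB.summable.norm
  have hP := hA.mul hB h3
  have hQ : HasSum (dualGenTerm M c u w ∘ pairEquiv) (dualGenFun M c u w) := by
    refine hP.congr_fun fun p ↦ ?_
    exact (dualGenTerm_eq M c u w p.1 p.2).symm
  exact pairEquiv.hasSum_iff.1 hQ

/-- **Jacobi's transformation formula for the coset generating function**: for `t > 0`,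
`G_c(t; w) = (M t)⁻¹ Ĝ_c(1/t; -iw/t)`. From `ϑ(z, τ) = (-iτ)^{-1/2} e^{-πi z²/τ} ϑ(z/τ, -1/τ)`
at `τ = iMt`: the two Gaussian prefactors multiply to `e^{-2πiwc + πtN(c)/M}`, which cancels the
prefactor of `G_c` (harmonicity of `z ↦ e^{2πiwz}` restricted to the coset). [folklore] -/
theorem genFun_functional_equation {t : ℝ} (ht : 0 < t) (w : ℂ) :
    genFun M c t w = ((M : ℂ) * t)⁻¹ * dualGenFun M c (1 / t) (-I * w / t) := by
  have ht0 : (t : ℂ) ≠ 0 := ofReal_ne_zero.mpr ht.ne'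
  have hM : (M : ℂ) ≠ 0 := by exact_mod_cast NeZero.ne M
  have hMt : (M : ℂ) * t ≠ 0 := mul_ne_zero hM ht0
  have hτ0 : I * ((M : ℂ) * t) ≠ 0 := mul_ne_zero I_ne_zero hMt
  have h1 : -I * (I * ((M : ℂ) * t)) = M * t := by
    rw [← mul_assoc, neg_mul, I_mul_I, neg_neg, one_mul]
  set A : ℂ := ((M : ℂ) * t) ^ (1 / 2 : ℂ) with hA
  have hAA : A * A = M * t := by
    rw [hA, ← Complex.cpow_add _ _ hMt]
    norm_num
  have hA0 : A ≠ 0 := by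
    rw [hA, Ne, Complex.cpow_eq_zero_iff]
    exact fun h ↦ hMt h.1
  have h2 : ((M : ℂ) * w + (c.re : ℂ) * (I * t)) / (I * ((M : ℂ) * t)) =
      -I * w / t + (c.re : ℂ) / M := by
    rw [div_eq_iff hτ0]
    field_simp
    linear_combination ((M : ℂ) * w) * I_sq
  have h3 : -1 / (I * ((M : ℂ) * t)) = I * (((1 / t : ℝ)) : ℂ) / M := by
    rw [div_eq_iff hτ0]
    push_cast
    field_simp
    linear_combination (-1 : ℂ) * I_sq
  have h4 : ((M : ℂ) * (I * w) + (c.im : ℂ) * (I * t)) / (I * ((M : ℂ) * t)) =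
      I * (-I * w / t) + (c.im : ℂ) / M := by
    rw [div_eq_iff hτ0]
    field_simp
    linear_combination ((M : ℂ) * w) * I_sq
  have h5 : cexp ((((-π * t * (c.norm : ℝ) / M) : ℝ) : ℂ) + 2 * π * I * w * (c : ℂ)) *
      (cexp (-π * I * ((M : ℂ) * w + (c.re : ℂ) * (I * t)) ^ 2 / (I * ((M : ℂ) * t))) *
        cexp (-π * I * ((M : ℂ) * (I * w) + (c.im : ℂ) * (I * t)) ^ 2 / (I * ((M : ℂ) * t)))) = 1 := by
    rw [← Complex.exp_add, ← Complex.exp_add]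
    have hc : ((c.norm : ℤ) : ℂ) = (c.re : ℂ) ^ 2 + (c.im : ℂ) ^ 2 := by
      rw [Zsqrtd.norm_def]; push_cast; ring
    rw [show ((((-π * t * (c.norm : ℝ) / M) : ℝ) : ℂ) + 2 * π * I * w * (c : ℂ)) +
        (-π * I * ((M : ℂ) * w + (c.re : ℂ) * (I * t)) ^ 2 / (I * ((M : ℂ) * t)) +
          -π * I * ((M : ℂ) * (I * w) + (c.im : ℂ) * (I * t)) ^ 2 / (I * ((M : ℂ) * t))) = 0 by
      rw [GaussianInt.toComplex_def c]
      push_cast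
      rw [hc]
      field_simp
      linear_combination (-(π * (t ^ 2 * (c.re : ℂ) ^ 2 + t ^ 2 * (c.im : ℂ) ^ 2 + M ^ 2 * w ^ 2))) * I_sq]
    exact Complex.exp_zero
  unfold genFun dualGenFun
  rw [jacobiTheta₂_functional_equation ((M : ℂ) * w + (c.re : ℂ) * (I * t)) (I * ((M : ℂ) * t)),
    jacobiTheta₂_functional_equation ((M : ℂ) * (I * w) + (c.im : ℂ) * (I * t)) (I * ((M : ℂ) * t)),
    h1, ← hA, h2, h3, h4]
  set T1 := jacobiTheta₂ (-I * w / t + (c.re : ℂ) / M) (I * (((1 / t : ℝ)) : ℂ) / M)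
  set T2 := jacobiTheta₂ (I * (-I * w / t) + (c.im : ℂ) / M) (I * (((1 / t : ℝ)) : ℂ) / M)
  set E0 := cexp ((((-π * t * (c.norm : ℝ) / M) : ℝ) : ℂ) + 2 * π * I * w * (c : ℂ))
  set E1 := cexp (-π * I * ((M : ℂ) * w + (c.re : ℂ) * (I * t)) ^ 2 / (I * ((M : ℂ) * t)))
  set E2 := cexp (-π * I * ((M : ℂ) * (I * w) + (c.im : ℂ) * (I * t)) ^ 2 / (I * ((M : ℂ) * t)))
  calc E0 * (1 / A * E1 * T1 * (1 / A * E2 * T2)) = (E0 * (E1 * E2)) / (A * A) * (T1 * T2) := by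
        field_simp
    _ = ((M : ℂ) * t)⁻¹ * (T1 * T2) := by rw [h5, hAA, one_div]

/-! ### Gaussian families as entire power series in `w` -/

section Family

variable {M c}
variable (ρ : ℤ[i] → ℂ) (P : ℤ[i] → ℤ[i]) (s : ℝ) (a : ℂ)

/-- A Gaussian family `ρ(y) e^{-π s N(P y)} e^{2πi w a (P y)}` (`G_c`: `ρ = 1`, `P y = c + M y`,
`s = t/M`, `a = 1`; the transformed `Ĝ_c`: `ρ = (Mt)⁻¹ e(Re(y c̄)/M)`, `P = id`, `s = 1/(Mt)`,
`a = -i/t`). [folklore] -/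
def famTerm (w : ℂ) (y : ℤ[i]) : ℂ :=
  ρ y * ((rexp (-π * s * ((P y).norm : ℝ)) : ℝ) : ℂ) * cexp (2 * π * I * w * (a * ((P y : ℤ[i]) : ℂ)))

/-- Its Taylor coefficients `C_k = ∑_y ρ(y) e^{-π s N(P y)} (2πi a P y)^k / k!`. [folklore] -/
def famCoeff (k : ℕ) : ℂ :=
  ∑' y : ℤ[i], ρ y * ((rexp (-π * s * ((P y).norm : ℝ)) : ℝ) : ℂ) *
    ((2 * π * I * (a * ((P y : ℤ[i]) : ℂ))) ^ k / k !)

/-- The double family `ρ(y) e^{-π s N(P y)} (2πi w a P y)^k / k!` on `ℤ[i] × ℕ`. [folklore] -/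
def famDbl (w : ℂ) (p : ℤ[i] × ℕ) : ℂ :=
  ρ p.1 * ((rexp (-π * s * ((P p.1).norm : ℝ)) : ℝ) : ℂ) *
    ((2 * π * I * w * (a * ((P p.1 : ℤ[i]) : ℂ))) ^ p.2 / p.2 !)

variable {ρ P s a} {B : ℝ}

/-- Norm of the double family: `≤ B e^{-π s N(P y)} (2π |w||a| |P y|)^k / k!`. [folklore] -/
theorem norm_famDbl_le (hρ : ∀ y, ‖ρ y‖ ≤ B) (w : ℂ) (p : ℤ[i] × ℕ) :
    ‖famDbl ρ P s a w p‖ ≤ B * (rexp (-π * s * ((P p.1).norm : ℝ)) *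
      ((2 * π * (‖w‖ * ‖a‖) * ‖((P p.1 : ℤ[i]) : ℂ)‖) ^ p.2 / p.2 !)) := by
  rw [famDbl, norm_mul, norm_mul, norm_ofReal_exp, norm_div, norm_pow, Complex.norm_natCast,
    norm_mul, norm_mul, norm_mul, norm_mul, norm_mul, Complex.norm_two, Complex.norm_real,
    Real.norm_of_nonneg pi_pos.le, Complex.norm_I, mul_one]
  have h0 : 0 ≤ rexp (-π * s * ((P p.1).norm : ℝ)) *
      ((2 * π * (‖w‖ * ‖a‖) * ‖((P p.1 : ℤ[i]) : ℂ)‖) ^ p.2 / p.2 !) := by positivity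
  calc ‖ρ p.1‖ * rexp (-π * s * ((P p.1).norm : ℝ)) *
        ((2 * π * ‖w‖ * (‖a‖ * ‖((P p.1 : ℤ[i]) : ℂ)‖)) ^ p.2 / p.2 !)
      = ‖ρ p.1‖ * (rexp (-π * s * ((P p.1).norm : ℝ)) *
          ((2 * π * (‖w‖ * ‖a‖) * ‖((P p.1 : ℤ[i]) : ℂ)‖) ^ p.2 / p.2 !)) := by ring
    _ ≤ B * (rexp (-π * s * ((P p.1).norm : ℝ)) *
          ((2 * π * (‖w‖ * ‖a‖) * ‖((P p.1 : ℤ[i]) : ℂ)‖) ^ p.2 / p.2 !)) :=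
        mul_le_mul_of_nonneg_right (hρ p.1) h0

/-- The majorant is summable on `ℤ[i] × ℕ` (`s > 0`, `P` injective): it is a subfamily of the
majorant of `GaussianHecke.summable_majorant`. [folklore] -/
theorem summable_famMajorant (hP : Function.Injective P) (hs : 0 < s) {R : ℝ} (hR : 0 ≤ R) :
    Summable fun p : ℤ[i] × ℕ ↦ rexp (-π * s * ((P p.1).norm : ℝ)) *
      ((2 * π * R * ‖((P p.1 : ℤ[i]) : ℂ)‖) ^ p.2 / p.2 !) := by
  have h := GaussianHecke.summable_majorant hs hR
  have hinj : Function.Injective (fun p : ℤ[i] × ℕ ↦ (P p.1, p.2)) := by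
    intro p q hpq
    simp only [Prod.mk.injEq] at hpq
    exact Prod.ext (hP hpq.1) hpq.2
  have h2 : Summable ((fun p : ℤ[i] × ℕ ↦ rexp (-π * s * (p.1.norm : ℝ)) *
      ((2 * π * R * ‖(p.1 : ℂ)‖) ^ p.2 / p.2 !)) ∘ fun p : ℤ[i] × ℕ ↦ (P p.1, p.2)) :=
    h.comp_injective hinj
  simpa only [Function.comp_def] using h2

/-- The double family is absolutely summable. [folklore] -/
theorem summable_famDbl (hρ : ∀ y, ‖ρ y‖ ≤ B) (hP : Function.Injective P) (hs : 0 < s) (w : ℂ) :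
    Summable (famDbl ρ P s a w) :=
  Summable.of_norm_bounded ((summable_famMajorant hP hs (by positivity : 0 ≤ ‖w‖ * ‖a‖)).mul_left B)
    fun p ↦ norm_famDbl_le hρ w p

/-- Summing over `k` first: `∑_k famDbl (y, k) = famTerm y`. [folklore] -/
theorem hasSum_famDbl_fst (w : ℂ) (y : ℤ[i]) :
    HasSum (fun k : ℕ ↦ famDbl ρ P s a w (y, k)) (famTerm ρ P s a w y) := by
  have h : HasSum (fun k : ℕ ↦ (2 * π * I * w * (a * ((P y : ℤ[i]) : ℂ))) ^ k / k !)
      (cexp (2 * π * I * w * (a * ((P y : ℤ[i]) : ℂ)))) := by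
    rw [Complex.exp_eq_exp_ℂ]
    exact NormedSpace.expSeries_div_hasSum_exp _
  have h2 := h.mul_left (ρ y * ((rexp (-π * s * ((P y).norm : ℝ)) : ℝ) : ℂ))
  exact h2

/-- Summing over `y` first: `∑_y famDbl (y, k) = C_k w^k`. [folklore] -/
theorem hasSum_famDbl_snd (hρ : ∀ y, ‖ρ y‖ ≤ B) (hP : Function.Injective P) (hs : 0 < s)
    (w : ℂ) (k : ℕ) :
    HasSum (fun y : ℤ[i] ↦ famDbl ρ P s a w (y, k)) (famCoeff ρ P s a k * w ^ k) := by
  have hsum : Summable fun y : ℤ[i] ↦ famDbl ρ P s a w (y, k) :=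
    (summable_famDbl hρ hP hs w).prod_symm.prod_factor k
  have heq : (fun y : ℤ[i] ↦ famDbl ρ P s a w (y, k)) = fun y : ℤ[i] ↦
      (ρ y * ((rexp (-π * s * ((P y).norm : ℝ)) : ℝ) : ℂ) *
        ((2 * π * I * (a * ((P y : ℤ[i]) : ℂ))) ^ k / k !)) * w ^ k := by
    funext y
    simp only [famDbl]
    ring
  rw [heq] at hsum ⊢
  rw [famCoeff, ← tsum_mul_right]
  exact hsum.hasSum

/-- **Taylor expansion**: if `∑_y famTerm w y = F(w)` for all `w`, then `F(w) = ∑_k C_k w^k`.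
[folklore] -/
theorem hasSum_famCoeff_mul_pow (hρ : ∀ y, ‖ρ y‖ ≤ B) (hP : Function.Injective P) (hs : 0 < s)
    {F : ℂ → ℂ} (hF : ∀ w, HasSum (famTerm ρ P s a w) (F w)) (w : ℂ) :
    HasSum (fun k : ℕ ↦ famCoeff ρ P s a k * w ^ k) (F w) := by
  have hT := (summable_famDbl hρ hP hs w (a := a)).hasSum
  have h1 : HasSum (famTerm ρ P s a w) (∑' p, famDbl ρ P s a w p) :=
    hT.prod_fiberwise fun y ↦ hasSum_famDbl_fst w y
  have h2 : HasSum (fun k : ℕ ↦ famCoeff ρ P s a k * w ^ k) (∑' p, famDbl ρ P s a w p) :=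
    ((Equiv.prodComm ℕ ℤ[i]).hasSum_iff.2 hT).prod_fiberwise fun k ↦ hasSum_famDbl_snd hρ hP hs w k
  rwa [h1.unique (hF w)] at h2

/-- `‖C_k‖ r^k ≤ B ∑_y e^{-π s N(P y)} (2π r |a| |P y|)^k / k!`. [folklore] -/
theorem norm_famCoeff_mul_pow_le (hρ : ∀ y, ‖ρ y‖ ≤ B) (hP : Function.Injective P) (hs : 0 < s)
    {r : ℝ} (hr : 0 ≤ r) (k : ℕ) :
    ‖famCoeff ρ P s a k‖ * r ^ k ≤ B * ∑' y : ℤ[i], rexp (-π * s * ((P y).norm : ℝ)) *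
      ((2 * π * (r * ‖a‖) * ‖((P y : ℤ[i]) : ℂ)‖) ^ k / k !) := by
  have hs' : Summable fun y : ℤ[i] ↦ rexp (-π * s * ((P y).norm : ℝ)) *
      ((2 * π * (r * ‖a‖) * ‖((P y : ℤ[i]) : ℂ)‖) ^ k / k !) :=
    (summable_famMajorant hP hs (by positivity : 0 ≤ r * ‖a‖)).prod_symm.prod_factor k
  have h1 : ‖famCoeff ρ P s a k‖ * r ^ k = ‖famCoeff ρ P s a k * (r : ℂ) ^ k‖ := by
    rw [norm_mul, norm_pow, Complex.norm_real, Real.norm_of_nonneg hr]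
  rw [h1, ← (hasSum_famDbl_snd hρ hP hs (r : ℂ) k).tsum_eq, ← tsum_mul_left]
  refine tsum_of_norm_bounded (hs'.mul_left B).hasSum fun y ↦ ?_
  have := norm_famDbl_le (P := P) (s := s) (a := a) hρ (r : ℂ) (y, k)
  rwa [Complex.norm_real, Real.norm_of_nonneg hr] at this

/-- The power series `∑ C_k w^k` has infinite radius of convergence. [folklore] -/
theorem radius_ofScalars_famCoeff (hρ : ∀ y, ‖ρ y‖ ≤ B) (hP : Function.Injective P) (hs : 0 < s) :
    (FormalMultilinearSeries.ofScalars ℂ (famCoeff ρ P s a)).radius = ⊤ := by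
  have hB : 0 ≤ B := (norm_nonneg _).trans (hρ 0)
  refine FormalMultilinearSeries.radius_eq_top_of_summable_norm _ fun r ↦ ?_
  simp_rw [FormalMultilinearSeries.ofScalars_norm]
  refine Summable.of_nonneg_of_le (fun k ↦ by positivity)
    (fun k ↦ norm_famCoeff_mul_pow_le hρ hP hs r.coe_nonneg k) ?_
  exact ((summable_famMajorant hP hs (by positivity : 0 ≤ (r : ℝ) * ‖a‖)).prod_symm.prod).mul_left B

/-- **A Gaussian family sums to an entire power series with coefficients `C_k`.** [folklore] -/
theorem hasFPowerSeriesOnBall_of_hasSum (hρ : ∀ y, ‖ρ y‖ ≤ B) (hP : Function.Injective P)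
    (hs : 0 < s) {F : ℂ → ℂ} (hF : ∀ w, HasSum (famTerm ρ P s a w) (F w)) :
    HasFPowerSeriesOnBall F (FormalMultilinearSeries.ofScalars ℂ (famCoeff ρ P s a)) 0 ⊤ := by
  refine ⟨(radius_ofScalars_famCoeff hρ hP hs).ge, ENNReal.zero_lt_top, fun {w} _ ↦ ?_⟩
  simp_rw [FormalMultilinearSeries.ofScalars_apply_eq, smul_eq_mul, zero_add]
  exact hasSum_famCoeff_mul_pow hρ hP hs hF w

end Family

/-! ### The coset theta series and their transformation formula -/

/-- The summand `z^k e^{-π t N(z)/M}`, `z = c + M y`, of the coset theta series. [folklore] -/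
def thetaTerm (k : ℕ) (t : ℝ) (y : ℤ[i]) : ℂ :=
  ((pt M c y : ℤ[i]) : ℂ) ^ k * ((rexp (-π * t * ((pt M c y).norm : ℝ) / M) : ℝ) : ℂ)

/-- **The coset theta series with harmonic weight `z^k`**:
`Θ_k(t; c, M) = ∑_{z ≡ c (mod M)} z^k e^{-π t N(z)/M}` (Hecke 1920, §9, theta series of an ideal
class of `ℚ(i)` with Grössencharakter and ray-class condition). [folklore] -/
def theta (k : ℕ) (t : ℝ) : ℂ := ∑' y : ℤ[i], thetaTerm M c k t y

/-- The summand `e(Re(y c̄)/M) y^k e^{-π u N(y)/M}` of the dual theta series. [folklore] -/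
def dualThetaTerm (k : ℕ) (u : ℝ) (y : ℤ[i]) : ℂ :=
  addChar M c y * ((y : ℂ) ^ k * ((rexp (-π * u * (y.norm : ℝ) / M) : ℝ) : ℂ))

/-- **The dual (twisted) theta series** `Θ̂_k(u; c, M) = ∑_{y ∈ ℤ[i]} e(Re(y c̄)/M) y^k e^{-π u N(y)/M}`
(a finite combination of the `Θ_k(u; b, M)` over the classes `b (mod M)`). [folklore] -/
def dualTheta (k : ℕ) (u : ℝ) : ℂ := ∑' y : ℤ[i], dualThetaTerm M c k u y

variable {M c}

omit [NeZero M] in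
/-- `‖z^k e^{-π t N(z)/M}‖ ≤ k! · e^{-π (t/M) N(z)} e^{|z|}`. [folklore] -/
theorem norm_thetaTerm_le (k : ℕ) (t : ℝ) (y : ℤ[i]) :
    ‖thetaTerm M c k t y‖ ≤ k ! * (rexp (-π * (t / M) * ((pt M c y).norm : ℝ)) *
      rexp (2 * π * (1 / (2 * π)) * ‖((pt M c y : ℤ[i]) : ℂ)‖)) := by
  rw [thetaTerm, norm_mul, norm_ofReal_exp, norm_pow,
    show -π * t * ((pt M c y).norm : ℝ) / M = -π * (t / M) * ((pt M c y).norm : ℝ) by ring]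
  have h2π : 2 * π * (1 / (2 * π)) * ‖((pt M c y : ℤ[i]) : ℂ)‖ = ‖((pt M c y : ℤ[i]) : ℂ)‖ := by
    field_simp
  rw [h2π]
  have hk : (0 : ℝ) < k ! := by exact_mod_cast Nat.factorial_pos k
  have h := Real.pow_div_factorial_le_exp ‖((pt M c y : ℤ[i]) : ℂ)‖ (norm_nonneg _) k
  rw [div_le_iff₀ hk] at h
  calc ‖((pt M c y : ℤ[i]) : ℂ)‖ ^ k * rexp (-π * (t / M) * ((pt M c y).norm : ℝ))
      ≤ rexp ‖((pt M c y : ℤ[i]) : ℂ)‖ * k ! * rexp (-π * (t / M) * ((pt M c y).norm : ℝ)) := by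
        gcongr
    _ = k ! * (rexp (-π * (t / M) * ((pt M c y).norm : ℝ)) * rexp ‖((pt M c y : ℤ[i]) : ℂ)‖) := by
        ring

/-- The coset theta series converges absolutely for `t > 0`. [folklore] -/
theorem summable_norm_thetaTerm (k : ℕ) {t : ℝ} (ht : 0 < t) :
    Summable fun y : ℤ[i] ↦ ‖thetaTerm M c k t y‖ := by
  have h0 := GaussianHecke.summable_exp_mul_exp (div_pos ht (M_pos M)) (by positivity : (0 : ℝ) ≤ 1 / (2 * π))
  have h1 : Summable ((fun x : ℤ[i] ↦ rexp (-π * (t / M) * (x.norm : ℝ)) *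
      rexp (2 * π * (1 / (2 * π)) * ‖(x : ℂ)‖)) ∘ pt M c) := h0.comp_injective (pt_injective M c)
  refine Summable.of_nonneg_of_le (fun _ ↦ norm_nonneg _) (norm_thetaTerm_le k t) ?_
  have h2 := h1.mul_left (k ! : ℝ)
  simpa only [Function.comp_def] using h2

/-- `Θ_k(t; c, M) = ∑_{z ≡ c} z^k e^{-π t N(z)/M}` (the defining series converges for `t > 0`).
[folklore] -/
theorem hasSum_theta (k : ℕ) {t : ℝ} (ht : 0 < t) : HasSum (thetaTerm M c k t) (theta M c k t) :=
  (summable_norm_thetaTerm k ht).of_norm.hasSum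

omit [NeZero M] in
/-- `‖e(Re(y c̄)/M) y^k e^{-π u N(y)/M}‖ ≤ k! · e^{-π (u/M) N(y)} e^{|y|}`. [folklore] -/
theorem norm_dualThetaTerm_le (k : ℕ) (u : ℝ) (y : ℤ[i]) :
    ‖dualThetaTerm M c k u y‖ ≤ k ! * (rexp (-π * (u / M) * (y.norm : ℝ)) *
      rexp (2 * π * (1 / (2 * π)) * ‖(y : ℂ)‖)) := by
  rw [dualThetaTerm, norm_mul, norm_addChar, one_mul, norm_mul, norm_ofReal_exp, norm_pow,
    show -π * u * (y.norm : ℝ) / M = -π * (u / M) * (y.norm : ℝ) by ring]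
  have h2π : 2 * π * (1 / (2 * π)) * ‖(y : ℂ)‖ = ‖(y : ℂ)‖ := by
    field_simp
  rw [h2π]
  have hk : (0 : ℝ) < k ! := by exact_mod_cast Nat.factorial_pos k
  have h := Real.pow_div_factorial_le_exp ‖(y : ℂ)‖ (norm_nonneg _) k
  rw [div_le_iff₀ hk] at h
  calc ‖(y : ℂ)‖ ^ k * rexp (-π * (u / M) * (y.norm : ℝ))
      ≤ rexp ‖(y : ℂ)‖ * k ! * rexp (-π * (u / M) * (y.norm : ℝ)) := by gcongr
    _ = k ! * (rexp (-π * (u / M) * (y.norm : ℝ)) * rexp ‖(y : ℂ)‖) := by ring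

/-- The dual theta series converges absolutely for `u > 0`. [folklore] -/
theorem summable_norm_dualThetaTerm (k : ℕ) {u : ℝ} (hu : 0 < u) :
    Summable fun y : ℤ[i] ↦ ‖dualThetaTerm M c k u y‖ :=
  Summable.of_nonneg_of_le (fun _ ↦ norm_nonneg _) (norm_dualThetaTerm_le k u)
    ((GaussianHecke.summable_exp_mul_exp (div_pos hu (M_pos M)) (by positivity)).mul_left _)

/-- `Θ̂_k(u; c, M) = ∑_y e(Re(y c̄)/M) y^k e^{-π u N(y)/M}` for `u > 0`. [folklore] -/
theorem hasSum_dualTheta (k : ℕ) {u : ℝ} (hu : 0 < u) :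
    HasSum (dualThetaTerm M c k u) (dualTheta M c k u) :=
  (summable_norm_dualThetaTerm k hu).of_norm.hasSum

omit [NeZero M] in
/-- `G_c(t; ·)` is the Gaussian family with `ρ = 1`, `P = (c + M ·)`, `s = t/M`, `a = 1`. [folklore] -/
theorem genTerm_eq_famTerm (t : ℝ) (w : ℂ) (y : ℤ[i]) :
    genTerm M c t w y = famTerm (fun _ ↦ (1 : ℂ)) (pt M c) (t / M) 1 w y := by
  rw [genTerm, famTerm, one_mul, one_mul,
    show -π * t * ((pt M c y).norm : ℝ) / M = -π * (t / M) * ((pt M c y).norm : ℝ) by ring]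

/-- The transformed function `(Mt)⁻¹ Ĝ_c(1/t; -iw/t)` is the sum of the Gaussian family with
`ρ = (Mt)⁻¹ e(Re(y c̄)/M)`, `P = id`, `s = (1/t)/M`, `a = -i/t`. [folklore] -/
theorem hasSum_transformed {t : ℝ} (ht : 0 < t) (w : ℂ) :
    HasSum (famTerm (fun y ↦ ((M : ℂ) * t)⁻¹ * addChar M c y) id (1 / t / M) (-I / t) w)
      (((M : ℂ) * t)⁻¹ * dualGenFun M c (1 / t) (-I * w / t)) := by
  have h := (hasSum_dualGenFun M c (one_div_pos.mpr ht) (-I * w / t)).mul_left ((M : ℂ) * t)⁻¹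
  refine h.congr_fun fun y ↦ ?_
  simp only [famTerm, dualGenTerm, id]
  rw [show -π * (1 / t) * (y.norm : ℝ) / M = -π * (1 / t / M) * (y.norm : ℝ) by ring,
    show 2 * π * I * (-I * w / t) * (y : ℂ) = 2 * π * I * w * (-I / t * (y : ℂ)) by ring]
  ring

/-- The Taylor coefficients of `G_c(t; ·)`: `C_k = (2πi)^k / k! · Θ_k(t; c, M)`. [folklore] -/
theorem famCoeff_gen_eq (k : ℕ) {t : ℝ} (ht : 0 < t) :
    famCoeff (fun _ ↦ (1 : ℂ)) (pt M c) (t / M) 1 k = (2 * π * I) ^ k / k ! * theta M c k t := by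
  rw [famCoeff, ← (hasSum_theta k ht).tsum_eq, ← tsum_mul_left]
  congr 1
  funext y
  rw [thetaTerm, one_mul, one_mul, mul_pow,
    show -π * t * ((pt M c y).norm : ℝ) / M = -π * (t / M) * ((pt M c y).norm : ℝ) by ring]
  ring

/-- The Taylor coefficients of the transformed function:
`C'_k = (Mt)⁻¹ (-i/t)^k (2πi)^k / k! · Θ̂_k(1/t; c, M)`. [folklore] -/
theorem famCoeff_transformed_eq (k : ℕ) {t : ℝ} (ht : 0 < t) :
    famCoeff (fun y ↦ ((M : ℂ) * t)⁻¹ * addChar M c y) id (1 / t / M) (-I / t) k =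
      ((M : ℂ) * t)⁻¹ * (-I / t) ^ k * ((2 * π * I) ^ k / k !) * dualTheta M c k (1 / t) := by
  rw [famCoeff, ← (hasSum_dualTheta k (one_div_pos.mpr ht)).tsum_eq, ← tsum_mul_left]
  congr 1
  funext y
  simp only [dualThetaTerm, id]
  rw [show -π * (1 / t) * (y.norm : ℝ) / M = -π * (1 / t / M) * (y.norm : ℝ) by ring, mul_pow,
    mul_pow]
  ring

/-- **Equality of the Taylor coefficients** of the two sides of `genFun_functional_equation`.
[folklore] -/
theorem famCoeff_gen_eq_transformed {t : ℝ} (ht : 0 < t) (k : ℕ) :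
    famCoeff (fun _ ↦ (1 : ℂ)) (pt M c) (t / M) 1 k =
      famCoeff (fun y ↦ ((M : ℂ) * t)⁻¹ * addChar M c y) id (1 / t / M) (-I / t) k := by
  have hs1 : 0 < t / M := div_pos ht (M_pos M)
  have hs2 : 0 < 1 / t / M := div_pos (one_div_pos.mpr ht) (M_pos M)
  have hρ1 : ∀ y : ℤ[i], ‖(fun _ ↦ (1 : ℂ)) y‖ ≤ 1 := fun y ↦ by simp
  have hρ2 : ∀ y : ℤ[i], ‖((M : ℂ) * t)⁻¹ * addChar M c y‖ ≤ ‖((M : ℂ) * t)⁻¹‖ := fun y ↦ by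
    rw [norm_mul, norm_addChar, mul_one]
  have h1 := (hasFPowerSeriesOnBall_of_hasSum (a := 1) hρ1 (pt_injective M c) hs1
    (F := genFun M c t) (fun w ↦ by
      have := hasSum_genFun M c ht w
      exact this.congr_fun fun y ↦ (genTerm_eq_famTerm t w y).symm))
  have h2 := hasFPowerSeriesOnBall_of_hasSum hρ2 Function.injective_id hs2 (hasSum_transformed ht)
  have heq : ∀ᶠ w in 𝓝 (0 : ℂ), genFun M c t w = ((M : ℂ) * t)⁻¹ * dualGenFun M c (1 / t) (-I * w / t) :=
    Eventually.of_forall fun w ↦ genFun_functional_equation M c ht w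
  have h := h1.hasFPowerSeriesAt.eq_formalMultilinearSeries_of_eventually h2.hasFPowerSeriesAt heq
  rw [FormalMultilinearSeries.ofScalars_series_eq_iff] at h
  exact congrFun h k

/-- **Transformation formula for the coset theta series** (Hecke 1920, §9, for `ℚ(i)`):
`Θ_k(t; c, M) = (Mt)⁻¹ (-i/t)^k Θ̂_k(1/t; c, M)` for `t > 0`. [folklore] -/
theorem theta_eq_dualTheta (k : ℕ) {t : ℝ} (ht : 0 < t) :
    theta M c k t = ((M : ℂ) * t)⁻¹ * (-I / t) ^ k * dualTheta M c k (1 / t) := by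
  have hc : ((2 * π * I) ^ k / k ! : ℂ) ≠ 0 := by
    refine div_ne_zero (pow_ne_zero _ ?_) (by exact_mod_cast (Nat.factorial_pos k).ne')
    exact mul_ne_zero (mul_ne_zero two_ne_zero (ofReal_ne_zero.mpr pi_pos.ne')) I_ne_zero
  have h := famCoeff_gen_eq_transformed (M := M) (c := c) ht k
  rw [famCoeff_gen_eq k ht, famCoeff_transformed_eq k ht] at h
  exact mul_left_cancel₀ hc (h.trans (by ring))

/-- **Transformation formula, Mellin-ready form**: for `x > 0`,
`Θ_k(1/x; c, M) = (-i)^k M⁻¹ x^{k+1} Θ̂_k(x; c, M)` — the shape `f(1/x) = ε x^{k+1} g(x)` of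
Mathlib's `WeakFEPair`, with `ε = (-i)^k / M`. [folklore] -/
theorem theta_one_div (k : ℕ) {x : ℝ} (hx : 0 < x) :
    theta M c k (1 / x) = (-I) ^ k * ((M : ℂ))⁻¹ * (x : ℂ) ^ (k + 1) * dualTheta M c k x := by
  have hx0 : (x : ℂ) ≠ 0 := ofReal_ne_zero.mpr hx.ne'
  have hM : (M : ℂ) ≠ 0 := by exact_mod_cast NeZero.ne M
  have h := theta_eq_dualTheta (M := M) (c := c) k (one_div_pos.mpr hx)
  rw [one_div_one_div] at h
  rw [h]
  push_cast
  field_simp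
  ring

end GaussianCosetTheta

end Literature.NumberTheory.LFunctions
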